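import Literature.Analysis.TotalPositivity.GeneralizedVandermonde
import Literature.Barriers.ValiantsHypothesis.AlgebraicNaturalProofsKRSTVNP

/-!
# Partition minors are hit by `VNP`-succinct points — total positivity, not isolation

Workshop decomp-valiant, lens «natural-proofs / succinctness axis» (decomp-val-lens-2 g36,
offer O-L2-12, CALL STATUS l.1052; helper `--supports` item 19717; closes NO item).

Route BarrierLever's OPEN support item `PartitionMinorsHitByVP` (stmt-19717) asks that every
square minor `[U, W]` of Nisan's balanced partition matrix `M_f[U, W] = coeff_{x^U y^W} f`
(`U, W ⊆ Fin h`; injective row/column families `u, w`) be non-singular at some `f` with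
SMALL CIRCUITS — the `𝒞 = VP` column of the read-once determinant row of Forbes–Shpilka–Volk
§8 («if one could establish a circuit class `𝒞` where there are `𝒞`-succinct hitting sets for
read-once determinants then … no proof technique following [Nisan, Raz, Raz–Yehudayoff] can
prove lower bounds for `𝒞`»). This file DECIDES THE `𝒞 = VNP` COLUMN of that row,
unconditionally, over every field of characteristic `0`, with ONE definable point per `h`:
`f_h = Σ_{e ∈ {0,1}^{2h}} selProd(e; x, y) · ∏_{a,c} (1 + (2^{2^{a+c}} − 1) e_{x_a} e_{y_c})`
(`L ≤ 4h² + 11h + 1`, `deg ≤ 2h² + 4h`, `deg f_h ≤ 2h`: `f_h ∈ SmallDefinable F (h+h) 3`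
for `h ≥ 2` — KRST Def. 3 in the constants-allowed model: the doubly-exponential scalars
`2^{2^{a+c}}` are single constant gates of cost `0`, `complexity_C`). Its coefficients are
`coeff_{x^S y^T} f_h = 2^{bin S · bin T}` (`bin S = Nat.ofBits [· ∈ S]`), so EVERY square minor
of its partition matrix is `det [2^{A_i B_j}]` with `A = bin ∘ u`, `B = bin ∘ w` injective — up
to two sorting permutations a generalized Vandermonde determinant with distinct positive nodes
`2^{A_i}` and distinct exponents `B_j` (`0` allowed), non-zero by the tree's
`Literature.Analysis.TotalPositivity.det_pow_strictMono_ne_zero` (used BY NAME over `ℝ`,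
transported through `ℤ` by `RingHom.map_det`). TOTAL POSITIVITY of the kernel `2^{AB}` replaces
the ISOLATING WEIGHTS the general read-once row needs; the point does not depend on the minor.
Main results: `det_two_pow_mul_ne_zero`, `exists_smallDefinable_totallyNonsingular` (`b = 3`,
`h₀ = 2`: one `f` per `h` hits every partition minor), `partitionMinors_hit_smallDefinable`
(item 19717's statement with `SmallDefinable F` for `SmallCircuits ℂ`).
NOT touched: item 19717 itself (the `VP` column), `ReadOnceDeterminantsHitByVP` (stmt-20152)
and its `VNP` analogue (adversarial placements need isolation), the crux
`SuccinctHittingSetsForVP` (stmt-14610), `VP ≠ VNP`. No definitions, no Literature facts.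
References: [ForbesShpilkaVolk2018, §8]; [KumarRamyaSaptharishiTengse2022, Def. 3]; N. Nisan,
STOC 1991; [Gantmacher1984, Vol. 2, Ch. XIII §8, Ex. 1]; Fallat–Johnson (2011), Ex. 0.1.8.
-/

-- layout Summits/ValiantsHypothesis/ValiantsHypothesis forces the duplicated namespace component
set_option linter.dupNamespace false

noncomputable section

namespace Summit.ValiantsHypothesis.ValiantsHypothesis.Theorems.SuccinctPartitionMinors

open MvPolynomial Literature.Barriers.ValiantsHypothesis
open Literature.Computability.AlgebraicComplexity
open Literature.Computability.AlgebraicComplexity.CircuitArith (toK)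
open Literature.Computability.AlgebraicComplexity.BoolGadgets

/-! ### §1 The injective generalized Vandermonde determinant with base `2` -/

/-- `det [2^{A_i B_j}]` over any commutative ring is the cast of the integer determinant.
[folklore] -/
theorem det_two_pow_mul_eq_cast {R : Type*} [CommRing R] {r : ℕ} (A B : Fin r → ℕ) :
    (Matrix.of fun i j : Fin r => (2 : R) ^ (A i * B j)).det
      = (((Matrix.of fun i j : Fin r => (2 : ℤ) ^ (A i * B j)).det : ℤ) : R) := by
  have hmap := (Int.castRingHom R).map_det (Matrix.of fun i j : Fin r => (2 : ℤ) ^ (A i * B j))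
  have hmat : (Int.castRingHom R).mapMatrix (Matrix.of fun i j : Fin r => (2 : ℤ) ^ (A i * B j))
      = Matrix.of fun i j : Fin r => (2 : R) ^ (A i * B j) := by
    ext i j; simp
  rw [hmat] at hmap
  simpa using hmap.symm

/-- **`det [2^{A_i B_j}] ≠ 0` for injective `A, B`** over a field of characteristic `0`: sort
rows and columns and apply the generalized Vandermonde theorem to the nodes `2^{A_i}` and the
exponents `B_j`. [cite: Gantmacher1984, Vol. 2, Ch. XIII §8, Example 1] -/
theorem det_two_pow_mul_ne_zero {F : Type*} [Field F] [CharZero F] {r : ℕ} {A B : Fin r → ℕ}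
    (hA : Function.Injective A) (hB : Function.Injective B) :
    (Matrix.of fun i j : Fin r => (2 : F) ^ (A i * B j)).det ≠ 0 := by
  classical
  set σ : Equiv.Perm (Fin r) := Tuple.sort A
  set τ : Equiv.Perm (Fin r) := Tuple.sort B
  have hσ : StrictMono (A ∘ σ) :=
    (Tuple.monotone_sort A).strictMono_of_injective (hA.comp σ.injective)
  have hτ : StrictMono (B ∘ τ) :=
    (Tuple.monotone_sort B).strictMono_of_injective (hB.comp τ.injective)
  have hsorted : (Matrix.of fun i j : Fin r => ((2 : ℝ) ^ A (σ i)) ^ B (τ j)).det ≠ 0 :=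
    Literature.Analysis.TotalPositivity.det_pow_strictMono_ne_zero
      (fun i => (2 : ℝ) ^ A (σ i)) (B ∘ τ) (fun i => by positivity)
      (fun i j hij => pow_lt_pow_right₀ (by norm_num) (hσ hij)) hτ
  have hreal : (Matrix.of fun i j : Fin r => (2 : ℝ) ^ (A i * B j)).det ≠ 0 := by
    intro h0
    apply hsorted
    have hsub : (Matrix.of fun i j : Fin r => ((2 : ℝ) ^ A (σ i)) ^ B (τ j)) =
        ((Matrix.of fun i j : Fin r => (2 : ℝ) ^ (A i * B j)).submatrix σ id).submatrix
          id τ := by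
      ext i j
      simp [Matrix.submatrix_apply, pow_mul]
    rw [hsub, Matrix.det_permute', Matrix.det_permute, h0, mul_zero, mul_zero]
  rw [det_two_pow_mul_eq_cast, Int.cast_ne_zero] at hreal
  rw [det_two_pow_mul_eq_cast, Int.cast_ne_zero]
  exact hreal

/-! ### §2 Monomial bookkeeping for Boolean sums of «selector × weight» -/

section Point

variable {F : Type*} [Field F] {N : ℕ}

/-- `∏_{t ∈ s} X_t^{k t} = monomial (Σ_{t ∈ s} single t (k t)) 1`. [folklore] -/
theorem prod_X_pow_eq_monomial (s : Finset (Fin N)) (k : Fin N → ℕ) :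
    ∏ t ∈ s, (X t : MvPolynomial (Fin N) F) ^ k t =
      monomial (∑ t ∈ s, Finsupp.single t (k t)) 1 := by
  classical
  induction s using Finset.induction_on with
  | empty => simp
  | insert a s ha ih =>
    rw [Finset.prod_insert ha, Finset.sum_insert ha, ih, X_pow_eq_monomial, monomial_mul,
      one_mul]

/-- The selected multilinear monomial `∏_t (e_t ? X_t : 1) = x^{m(e)}`,
`m(e) = Σ_t single t [e t]`. [folklore] -/
theorem prod_ite_X_eq_monomial (e : Fin N → Bool) :
    ∏ t : Fin N, (if e t then (X t : MvPolynomial (Fin N) F) else 1) =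
      monomial (∑ t : Fin N, Finsupp.single t (e t).toNat) 1 := by
  rw [← prod_X_pow_eq_monomial]
  exact Finset.prod_congr rfl fun t _ => by cases e t <;> simp

/-- `e ↦ m(e) = Σ_t single t [e t]` is injective (`m(e) t = [e t]`). [folklore] -/
theorem sum_single_toNat_injective : Function.Injective fun e : Fin N → Bool =>
    (∑ t : Fin N, Finsupp.single t (e t).toNat : Fin N →₀ ℕ) := by
  classical
  intro e e' h
  funext t
  have h1 := congrArg (fun m : Fin N →₀ ℕ => m t) h
  simp only [Finsupp.finsetSum_apply, Finsupp.single_apply, Finset.sum_ite_eq',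
    Finset.mem_univ, if_true] at h1
  cases he : e t <;> cases he' : e' t <;> simp_all

/-- **The weight factor at a Boolean point**: `aeval (x, [e]) (rename inr W) = C (W([e]))`.
[cite: Valiant1979] -/
theorem aeval_boolPoint_rename_inr (e : Fin N → Bool) (W : MvPolynomial (Fin N) F) :
    aeval (Sum.elim X fun j => if e j then (1 : MvPolynomial (Fin N) F) else 0)
      (rename Sum.inr W) = C (eval (fun t => toK F (e t)) W) := by
  rw [aeval_rename]
  induction W using MvPolynomial.induction_on with
  | C a => rw [aeval_C, algebraMap_eq, eval_C]
  | add p q hp hq => rw [map_add, hp, hq, map_add, map_add]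
  | mul_X p j hp =>
    rw [map_mul, hp, aeval_X, map_mul, eval_X, map_mul, Function.comp_apply, Sum.elim_inr]
    cases e j <;> simp [toK]

/-! ### §3 The Boolean sum of «selector × weight»: coefficients, degree, size -/

/-- **The point.** `Σ_e selProd(e; x) · W(e) = Σ_e W([e]) · x^{m(e)}`: the coefficient at the
multilinear monomial `x^{m(e)}` is the weight `W` at the bit vector `e`. [cite: Valiant1979] -/
theorem boolSum_selProd_mul_rename (W : MvPolynomial (Fin N) F) :
    boolSum (selProd (fun t : Fin N => (X (Sum.inr t) : MvPolynomial (Fin N ⊕ Fin N) F))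
        (fun t => X (Sum.inl t)) * rename Sum.inr W) =
      ∑ e : Fin N → Bool, monomial (∑ t : Fin N, Finsupp.single t (e t).toNat)
        (eval (fun t => toK F (e t)) W) := by
  unfold boolSum
  refine Finset.sum_congr rfl fun e _ => ?_
  rw [map_mul, aeval_selProd _ _ _ e (fun t => by
    rw [aeval_X, Sum.elim_inr, algebraMap_eq]; cases e t <;> simp [toK]),
    aeval_boolPoint_rename_inr]
  have hsel : ∏ t : Fin N, (if e t then aeval (Sum.elim X fun j => if e j then
        (1 : MvPolynomial (Fin N) F) else 0) (X (Sum.inl t) : MvPolynomial (Fin N ⊕ Fin N) F)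
        else 1) = ∏ t : Fin N, (if e t then (X t : MvPolynomial (Fin N) F) else 1) :=
    Finset.prod_congr rfl fun t _ => by rw [aeval_X, Sum.elim_inl]
  rw [hsel, prod_ite_X_eq_monomial, mul_comm, C_mul_monomial, mul_one]

/-- **Coefficient extraction**: `coeff_{x^{m(e₀)}} (Σ_e W([e]) x^{m(e)}) = W([e₀])`.
[folklore] -/
theorem coeff_boolSum_selProd_mul_rename (W : MvPolynomial (Fin N) F) (e₀ : Fin N → Bool) :
    coeff (∑ t : Fin N, Finsupp.single t (e₀ t).toNat)
      (boolSum (selProd (fun t : Fin N => (X (Sum.inr t) : MvPolynomial (Fin N ⊕ Fin N) F))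
        (fun t => X (Sum.inl t)) * rename Sum.inr W)) = eval (fun t => toK F (e₀ t)) W := by
  classical
  rw [boolSum_selProd_mul_rename, coeff_sum]
  simp_rw [coeff_monomial]
  rw [Finset.sum_eq_single e₀ (fun e _ hne => if_neg fun h => hne (sum_single_toNat_injective h))
    (fun h => absurd (Finset.mem_univ _) h), if_pos rfl]

/-- The point has degree `≤ N` (it is multilinear in `x`). [folklore] -/
theorem totalDegree_boolSum_selProd_mul_rename_le (W : MvPolynomial (Fin N) F) :
    (boolSum (selProd (fun t : Fin N => (X (Sum.inr t) : MvPolynomial (Fin N ⊕ Fin N) F))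
        (fun t => X (Sum.inl t)) * rename Sum.inr W)).totalDegree ≤ N := by
  rw [boolSum_selProd_mul_rename]
  refine totalDegree_finsetSum_le fun e _ => ?_
  have hmon : monomial (∑ t : Fin N, Finsupp.single t (e t).toNat) (eval (fun t => toK F (e t)) W)
      = C (eval (fun t => toK F (e t)) W) *
          ∏ t : Fin N, (if e t then (X t : MvPolynomial (Fin N) F) else 1) := by
    rw [prod_ite_X_eq_monomial, C_mul_monomial, mul_one]
  rw [hmon]
  refine (totalDegree_mul _ _).trans ?_
  rw [totalDegree_C, zero_add]
  refine (totalDegree_finsetProd _ _).trans ?_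
  calc ∑ t : Fin N, (if e t then (X t : MvPolynomial (Fin N) F) else 1).totalDegree
      ≤ ∑ _t : Fin N, 1 := Finset.sum_le_sum fun t _ => by
        split_ifs
        · exact (totalDegree_X (R := F) t).le
        · simp
    _ = N := by simp

/-- Size of the summand: `L(selProd · W) ≤ 5N + L(W) + 1`. [cite: Burgisser2000, §2.1] -/
theorem complexity_selProd_mul_rename_le (W : MvPolynomial (Fin N) F) :
    complexity (selProd (fun t : Fin N => (X (Sum.inr t) : MvPolynomial (Fin N ⊕ Fin N) F))
        (fun t => X (Sum.inl t)) * rename Sum.inr W) ≤ 5 * N + complexity W + 1 := by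
  refine (complexity_mul_le_holds _ _).trans ?_
  have hsel : complexity (selProd (fun t : Fin N => (X (Sum.inr t) :
      MvPolynomial (Fin N ⊕ Fin N) F)) (fun t => X (Sum.inl t))) ≤ 5 * N := by
    refine (complexity_selProd_le _ _).trans ?_
    rw [Finset.sum_eq_zero fun t _ => by rw [complexity_X_holds, complexity_X_holds]; rfl, zero_add]
  have hren := complexity_rename_le_holds' (k := F) (Sum.inr : Fin N → Fin N ⊕ Fin N) W
  omega

/-- Degree of the summand: `deg (selProd · W) ≤ 2N + deg W`. [folklore] -/
theorem totalDegree_selProd_mul_rename_le (W : MvPolynomial (Fin N) F) :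
    (selProd (fun t : Fin N => (X (Sum.inr t) : MvPolynomial (Fin N ⊕ Fin N) F))
        (fun t => X (Sum.inl t)) * rename Sum.inr W).totalDegree ≤ 2 * N + W.totalDegree := by
  refine (totalDegree_mul _ _).trans ?_
  have hsel : (selProd (fun t : Fin N => (X (Sum.inr t) : MvPolynomial (Fin N ⊕ Fin N) F))
      (fun t => X (Sum.inl t))).totalDegree ≤ 2 * N := by
    refine (totalDegree_selProd_le _ _).trans ?_
    rw [Finset.sum_congr rfl fun t _ => by rw [totalDegree_X, totalDegree_X]]
    simp only [Finset.sum_const, Finset.card_univ, Fintype.card_fin, smul_eq_mul]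
    omega
  have hren := totalDegree_rename_le (Sum.inr : Fin N → Fin N ⊕ Fin N) W
  omega

/-! ### §4 The total-positivity weight `∏_{a,c} (1 + (2^{2^{a+c}} − 1) e_{x_a} e_{y_c})` -/

/-- `Σ_a single (x a) [a ∈ U] = Σ_{a ∈ U} single (x a) 1`. [folklore] -/
theorem sum_single_indicator {h : ℕ} {σ : Type*} (U : Finset (Fin h)) (x : Fin h → σ) :
    ∑ a : Fin h, Finsupp.single (x a) ((decide (a ∈ U)).toNat) =
      ∑ a ∈ U, Finsupp.single (x a) 1 := by
  classical
  rw [← Finset.sum_subset (Finset.subset_univ U) fun a _ ha => by simp [ha]]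
  exact Finset.sum_congr rfl fun a ha => by simp [ha]

/-- `U ↦ bin U = Nat.ofBits [· ∈ U]` is injective. [folklore] -/
theorem ofBits_indicator_injective {h : ℕ} :
    Function.Injective fun U : Finset (Fin h) => Nat.ofBits fun a : Fin h => decide (a ∈ U) := by
  intro U U' hUU'
  ext a
  simpa using congrFun (ofBits_injective hUU') a

/-- **The exponent of a partition-matrix entry is a bit vector**: `x^U y^W = x^{m(e)}` for
`e = ([· ∈ U], [· ∈ W])`. [cite: ForbesShpilkaVolk2018, §8] -/
theorem sum_single_append_indicator {h : ℕ} (U W : Finset (Fin h)) :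
    (∑ v : Fin (h + h), Finsupp.single v
        ((Fin.append (fun a => decide (a ∈ U)) (fun c => decide (c ∈ W)) v).toNat) :
        Fin (h + h) →₀ ℕ) =
      ∑ a ∈ U, Finsupp.single (Fin.castAdd h a) 1 +
        ∑ c ∈ W, Finsupp.single (Fin.natAdd h c) 1 := by
  rw [Fin.sum_univ_add]
  simp only [Fin.append_left, Fin.append_right]
  rw [sum_single_indicator U (Fin.castAdd h), sum_single_indicator W (Fin.natAdd h)]

/-- **The weight at a bit vector is `2^{bin(s) · bin(t)}`**, `bin = Nat.ofBits`:
`∏_{a,c} (1 + (2^{2^{a+c}} − 1) s_a t_c) = 2^{Σ_{a,c} 2^{a+c} s_a t_c} = 2^{bin(s) · bin(t)}`.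
[cite: Gantmacher1984, Vol. 2, Ch. XIII §8, Example 1] -/
theorem eval_weight_append (h : ℕ) (s t : Fin h → Bool) :
    eval (fun v => toK F (Fin.append s t v))
      (∏ a : Fin h, ∏ c : Fin h, (1 + C ((2 : F) ^ (2 ^ ((a : ℕ) + (c : ℕ))) - 1) *
        (X (Fin.castAdd h a) * X (Fin.natAdd h c))) : MvPolynomial (Fin (h + h)) F) =
      (2 : F) ^ (Nat.ofBits s * Nat.ofBits t) := by
  rw [map_prod]
  have hfac : ∀ a c : Fin h, eval (fun v => toK F (Fin.append s t v))
      ((1 + C ((2 : F) ^ (2 ^ ((a : ℕ) + (c : ℕ))) - 1) *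
        (X (Fin.castAdd h a) * X (Fin.natAdd h c))) : MvPolynomial (Fin (h + h)) F) =
      (2 : F) ^ (2 ^ ((a : ℕ) + (c : ℕ)) * ((s a).toNat * (t c).toNat)) := by
    intro a c
    simp only [map_add, map_one, map_mul, eval_C, eval_X, Fin.append_left, Fin.append_right]
    cases s a <;> cases t c <;> simp [toK]
  rw [Finset.prod_congr rfl fun a _ => by rw [map_prod, Finset.prod_congr rfl fun c _ => hfac a c,
    Finset.prod_pow_eq_pow_sum], Finset.prod_pow_eq_pow_sum]
  congr 1
  rw [ofBits_eq_sum, ofBits_eq_sum, Finset.sum_mul_sum]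
  exact Finset.sum_congr rfl fun a _ => Finset.sum_congr rfl fun c _ => by rw [pow_add]; ring

/-- Size of the weight: `≤ 4h² + h` (three gates a factor, one product gate each).
[cite: Burgisser2000, §2.1] -/
theorem complexity_weight_le (h : ℕ) :
    complexity (∏ a : Fin h, ∏ c : Fin h, (1 + C ((2 : F) ^ (2 ^ ((a : ℕ) + (c : ℕ))) - 1) *
        (X (Fin.castAdd h a) * X (Fin.natAdd h c))) : MvPolynomial (Fin (h + h)) F) ≤
      4 * h ^ 2 + h := by
  have hcard : (Finset.univ : Finset (Fin h)).card = h := by simp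
  have hfac : ∀ a c : Fin h, complexity ((1 + C ((2 : F) ^ (2 ^ ((a : ℕ) + (c : ℕ))) - 1) *
      (X (Fin.castAdd h a) * X (Fin.natAdd h c))) : MvPolynomial (Fin (h + h)) F) ≤ 3 := by
    intro a c
    have h1 : complexity (1 : MvPolynomial (Fin (h + h)) F) = 0 := by
      rw [← C_1]; exact complexity_C_holds _
    have h2 := complexity_add_le_holds (1 : MvPolynomial (Fin (h + h)) F)
      (C ((2 : F) ^ (2 ^ ((a : ℕ) + (c : ℕ))) - 1) * (X (Fin.castAdd h a) * X (Fin.natAdd h c)))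
    have h3 := complexity_mul_le_holds (C ((2 : F) ^ (2 ^ ((a : ℕ) + (c : ℕ))) - 1) :
      MvPolynomial (Fin (h + h)) F) (X (Fin.castAdd h a) * X (Fin.natAdd h c))
    have h4 := complexity_mul_le_holds (X (Fin.castAdd h a) : MvPolynomial (Fin (h + h)) F)
      (X (Fin.natAdd h c))
    have h5 := complexity_C_holds (σ := Fin (h + h)) ((2 : F) ^ (2 ^ ((a : ℕ) + (c : ℕ))) - 1)
    have h6 := complexity_X_holds (k := F) (σ := Fin (h + h)) (Fin.castAdd h a)
    have h7 := complexity_X_holds (k := F) (σ := Fin (h + h)) (Fin.natAdd h c)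
    omega
  have hin : ∀ a : Fin h, complexity (∏ c : Fin h,
      (1 + C ((2 : F) ^ (2 ^ ((a : ℕ) + (c : ℕ))) - 1) * (X (Fin.castAdd h a) *
        X (Fin.natAdd h c))) : MvPolynomial (Fin (h + h)) F) ≤ 4 * h := by
    intro a
    refine (complexity_finset_prod_le _ _).trans ?_
    have := Finset.sum_le_sum fun c (_ : c ∈ (Finset.univ : Finset (Fin h))) => hfac a c
    rw [Finset.sum_const, hcard, smul_eq_mul] at this
    omega
  refine (complexity_finset_prod_le _ _).trans ?_
  have := Finset.sum_le_sum fun a (_ : a ∈ (Finset.univ : Finset (Fin h))) => hin a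
  rw [Finset.sum_const, hcard, smul_eq_mul] at this
  nlinarith

/-- Degree of the weight: `≤ 2h²`. [folklore] -/
theorem totalDegree_weight_le (h : ℕ) :
    (∏ a : Fin h, ∏ c : Fin h, (1 + C ((2 : F) ^ (2 ^ ((a : ℕ) + (c : ℕ))) - 1) *
        (X (Fin.castAdd h a) * X (Fin.natAdd h c))) :
        MvPolynomial (Fin (h + h)) F).totalDegree ≤ 2 * h ^ 2 := by
  have hcard : (Finset.univ : Finset (Fin h)).card = h := by simp
  have hfac : ∀ a c : Fin h, ((1 + C ((2 : F) ^ (2 ^ ((a : ℕ) + (c : ℕ))) - 1) *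
      (X (Fin.castAdd h a) * X (Fin.natAdd h c))) :
      MvPolynomial (Fin (h + h)) F).totalDegree ≤ 2 := by
    intro a c
    refine (totalDegree_add _ _).trans (max_le (by simp) ?_)
    refine (totalDegree_mul _ _).trans ?_
    rw [totalDegree_C, zero_add]
    refine (totalDegree_mul _ _).trans ?_
    rw [totalDegree_X, totalDegree_X]
  have hin : ∀ a : Fin h, (∏ c : Fin h, (1 + C ((2 : F) ^ (2 ^ ((a : ℕ) + (c : ℕ))) - 1) *
      (X (Fin.castAdd h a) * X (Fin.natAdd h c))) :
      MvPolynomial (Fin (h + h)) F).totalDegree ≤ 2 * h := by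
    intro a
    refine (totalDegree_finsetProd _ _).trans ?_
    have := Finset.sum_le_sum fun c (_ : c ∈ (Finset.univ : Finset (Fin h))) => hfac a c
    rw [Finset.sum_const, hcard, smul_eq_mul] at this
    omega
  refine (totalDegree_finsetProd _ _).trans ?_
  have := Finset.sum_le_sum fun a (_ : a ∈ (Finset.univ : Finset (Fin h))) => hin a
  rw [Finset.sum_const, hcard, smul_eq_mul] at this
  nlinarith

end Point

/-! ### §5 The theorems -/

/-- **Partition minors are hit by ONE `VNP`-succinct point per `h` (total positivity).**
For every field `F` of characteristic `0`: with `b = 3`, `h₀ = 2`, for every `h ≥ h₀` some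
`f ∈ SmallDefinable F (h+h) b` (KRST Def. 3) has ALL square minors `[U, W]` of its balanced
partition matrix `(coeff_{x^{u i} y^{w j}} f)_{i,j}` non-singular, for all injective
`u, w : Fin r → 𝒫(Fin h)` and every `r` (its coefficients are `2^{bin(u i) · bin(w j)}`). The
`𝒞 = VNP` column of the read-once determinant row of [ForbesShpilkaVolk2018, §8] for Nisan's
partition matrices; the `VP` column is route BarrierLever's item `PartitionMinorsHitByVP`.
[cite: ForbesShpilkaVolk2018, §8] [cite: KumarRamyaSaptharishiTengse2022, Def. 3]
[cite: Gantmacher1984, Vol. 2, Ch. XIII §8, Example 1] -/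
theorem exists_smallDefinable_totallyNonsingular (F : Type*) [Field F] [CharZero F] :
    ∃ b h₀ : ℕ, ∀ h : ℕ, h₀ ≤ h → ∃ f ∈ SmallDefinable F (h + h) b,
      ∀ (r : ℕ) (u w : Fin r → Finset (Fin h)), Function.Injective u →
        Function.Injective w →
          (Matrix.of fun i j : Fin r => MvPolynomial.coeff
            (∑ a ∈ u i, Finsupp.single (Fin.castAdd h a) 1 +
              ∑ c ∈ w j, Finsupp.single (Fin.natAdd h c) 1) f).det ≠ 0 := by
  classical
  refine ⟨3, 2, fun h hh => ?_⟩
  refine ⟨boolSum (selProd (fun t : Fin (h + h) => (X (Sum.inr t) :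
      MvPolynomial (Fin (h + h) ⊕ Fin (h + h)) F)) (fun t => X (Sum.inl t)) *
      rename Sum.inr (∏ a : Fin h, ∏ c : Fin h,
        (1 + C ((2 : F) ^ (2 ^ ((a : ℕ) + (c : ℕ))) - 1) * (X (Fin.castAdd h a) *
          X (Fin.natAdd h c))) : MvPolynomial (Fin (h + h)) F)), ?_, ?_⟩
  · have hN : h + h ≤ (h + h) ^ 3 := Nat.le_self_pow (by norm_num) _
    have h3 : (h + h) ^ 3 = 8 * (h * (h * h)) := by ring
    have h4 : 2 * (h * h) ≤ h * (h * h) := Nat.mul_le_mul_right _ hh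
    have h5 : h ≤ h * h := Nat.le_mul_self h
    refine ⟨totalDegree_boolSum_selProd_mul_rename_le _, h + h, hN, _,
      (complexity_selProd_mul_rename_le _).trans ?_,
      (totalDegree_selProd_mul_rename_le _).trans ?_, rfl⟩
    · have h2 := complexity_weight_le (F := F) h
      nlinarith
    · have h2 := totalDegree_weight_le (F := F) h
      nlinarith
  · intro r u w hu hw
    have hA := ofBits_indicator_injective.comp hu
    have hB := ofBits_indicator_injective.comp hw
    convert det_two_pow_mul_ne_zero (F := F) hA hB using 4 with i
    funext j
    rw [← sum_single_append_indicator, coeff_boolSum_selProd_mul_rename, eval_weight_append]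
    rfl

/-- **Item `PartitionMinorsHitByVP`'s statement with `VNP`-succinct (`SmallDefinable`) in place
of `VP`-succinct (`SmallCircuits`)**: every balanced-partition minor `[U, W]` is non-singular at
some `f ∈ SmallDefinable F (h+h) b`, uniformly in `h ≥ h₀` (here even one `f` for all minors).
[cite: ForbesShpilkaVolk2018, §8] [cite: KumarRamyaSaptharishiTengse2022, Def. 3] -/
theorem partitionMinors_hit_smallDefinable (F : Type*) [Field F] [CharZero F] :
    ∃ b h₀ : ℕ, ∀ h : ℕ, h₀ ≤ h → ∀ (r : ℕ) (u w : Fin r → Finset (Fin h)),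
      Function.Injective u → Function.Injective w →
        ∃ f ∈ SmallDefinable F (h + h) b,
          (Matrix.of fun i j : Fin r => MvPolynomial.coeff
            (∑ a ∈ u i, Finsupp.single (Fin.castAdd h a) 1 +
              ∑ c ∈ w j, Finsupp.single (Fin.natAdd h c) 1) f).det ≠ 0 := by
  obtain ⟨b, h₀, H⟩ := exists_smallDefinable_totallyNonsingular F
  refine ⟨b, h₀, fun h hh r u w hu hw => ?_⟩
  obtain ⟨f, hf, hfit⟩ := H h hh
  exact ⟨f, hf, hfit r u w hu hw⟩

end Summit.ValiantsHypothesis.ValiantsHypothesis.Theorems.SuccinctPartitionMinors
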